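import Summits.AtomisticToContinuum.HydrodynamicLimit.Theorems.InformationPercolationEngineChaosClosesEulerPressureValueC
import HarnessLib

/-!
# Collisional pressure value in band (crux `ChaosClosesEuler`, stmt-AtomisticToContinuum-15141, line `Sketch`,
# stub `stub_pressureValueOfEnskog`) — helper D: calculus of the normalised collision sum along a good orbit

WHAT. Along ONE good orbit of the hard-sphere flow the normalised collision sum
`collisionSum σ N Φ τ χ g Ξ r z = (ε/(N+1)) Σ_{collisions s ≤ τ} Σ_{contact pairs} χ(s, xᵢ) g(σ³ρ_r(xᵢ)) Ξ(n̂, vᵢ⁻, vⱼ⁻)`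
(Literature vocabulary `EvenCollisionTubeFunctional.collisionSum`) is an honest finite sum, and we record its
bookkeeping: linearity and monotonicity in the space–time weight `χ`, the termwise comparison
`|K[χ₁ g₁ Ξ₁] − K[χ₂ g₂ Ξ₂]| ≤ K[χ₃ g₃ Ξ₃]` (every recorded normal is a unit vector), restriction of the time window by
an indicator weight, the EXCHANGE of a `(t₀, x₀)`-integral with the collision sum for the tent × cone windowed weight
(`integral_integral_mul_collisionSum_window`: testing the windowed collision statistic against `a(t₀, x₀)` produces
the collision sum with the smoothed coefficient `ã` of helper C), and the BOUNDARY-LAYER inequality: the collisions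
`s` with `[s, s + r] ⊆ [lo, hi]` are counted at most twice by `∫_{t₀ ∈ [lo,hi]} ∫_{x₀}` of the windowed statistic
(half of the tent mass lies to the right of its centre).

References: M. Pulvirenti, S. Simonella, arXiv:1504.03215, §3 (collision sums of one trajectory);
C. Cercignani, R. Illner, M. Pulvirenti (1994), App. 4.A.
-/

noncomputable section

namespace Summit.AtomisticToContinuum.HydrodynamicLimit.Theorems.ChaosClosesEulerPressureValue

open scoped BigOperators Topology Classical MeasureTheory ENNReal InnerProductSpace
open Filter Set MeasureTheory
open Literature.MathematicalPhysics.KineticTheory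
open Literature.Analysis.FluidPDE
open Summit.AtomisticToContinuum.HydrodynamicLimit.Theorems.LocalSecondLawNegative
open Summit.AtomisticToContinuum.HydrodynamicLimit.Theorems.LocalSecondLawLedger
open Summit.AtomisticToContinuum.HydrodynamicLimit.Theorems.LocalSecondLawLedger.L
  (Mmom rhoC_eq_sum momC_apply_eq_sum momC_eq_sum kinC_eq_trace norm_sq_eq_sum)

/-- The truncated stress mark `𝒯[L,k,l]` (local notation for an explicit lambda). -/
local notation3 "𝒯[" L ", " k ", " l "]" => fun q : V3 × V3 × V3 =>
  min |⟪q.2.1 - q.2.2, q.1⟫_ℝ| (4 * L) * (speedCutoff L ‖q.2.1‖ * speedCutoff L ‖q.2.2‖) * (clip1 (q.1 k) * clip1 (q.1 l))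

/-- The dominating mark `ℬ[L]` (local notation for an explicit lambda). -/
local notation3 "ℬ[" L "]" => fun q : V3 × V3 × V3 => 4 * L * (speedCutoff L ‖q.2.1‖ * speedCutoff L ‖q.2.2‖)

section CollisionSum

variable {σ : ℝ} {N : ℕ} (Φ : HardSphereFlow (Torus.geometry (Fin 3)) (hsDiameter σ N) (N + 1))
  {z : Config (N + 1) (Fin 3) T3}

/-- The collision times of a good orbit in a bounded window form a finite set. [folklore] -/
theorem finite_collisionTimes_Icc (hz : z ∈ Φ.good) (τ : ℝ) :
    (collisionTimes (Torus.geometry (Fin 3)) (hsDiameter σ N) (fun s => Φ.flow s z) ∩ Icc 0 τ).Finite :=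
  (Φ.isTrajectory z hz).locFinite 0 τ

/-- **The collision sum as an honest finite sum** along a good orbit. [folklore] -/
theorem collisionSum_eq_sum (hz : z ∈ Φ.good) (τ : ℝ) (χ : ℝ × T3 → ℝ) (g : ℝ → ℝ) (Ξ : V3 × V3 × V3 → ℝ) (r : ℝ) :
    collisionSum σ N Φ τ χ g Ξ r z = hsDiameter σ N / (N + 1 : ℝ) *
      ∑ s ∈ (finite_collisionTimes_Icc Φ hz τ).toFinset, ∑ i : Fin (N + 1), ∑ j : Fin (N + 1),
        (if i ≠ j ∧ ‖(Torus.geometry (Fin 3)).sepVec (Φ.flow s z i).1 (Φ.flow s z j).1‖ = hsDiameter σ N then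
          χ (s, (Φ.flow s z i).1) * g (σ ^ 3 * mollDensity r (Φ.flow s z) (Φ.flow s z i).1) *
            Ξ ((hsDiameter σ N)⁻¹ • (Torus.geometry (Fin 3)).sepVec (Φ.flow s z i).1 (Φ.flow s z j).1,
              (reflectVel ((Torus.geometry (Fin 3)).sepVec (Φ.flow s z i).1 (Φ.flow s z j).1)
                ((Φ.flow s z i).2, (Φ.flow s z j).2)).1,
              (reflectVel ((Torus.geometry (Fin 3)).sepVec (Φ.flow s z i).1 (Φ.flow s z j).1)
                ((Φ.flow s z i).2, (Φ.flow s z j).2)).2)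
        else 0) := by
  dsimp only [Literature.MathematicalPhysics.KineticTheory.collisionSum]
  rw [finsum_mem_eq_finite_toFinset_sum _ (finite_collisionTimes_Icc Φ hz τ)]

/-- **Linearity in the weight**: `K[(χ₁ + χ₂) g Ξ] = K[χ₁ g Ξ] + K[χ₂ g Ξ]`. [folklore] -/
theorem collisionSum_add (hz : z ∈ Φ.good) (τ : ℝ) (χ₁ χ₂ : ℝ × T3 → ℝ) (g : ℝ → ℝ) (Ξ : V3 × V3 × V3 → ℝ)
    (r : ℝ) :
    collisionSum σ N Φ τ (fun p => χ₁ p + χ₂ p) g Ξ r z =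
      collisionSum σ N Φ τ χ₁ g Ξ r z + collisionSum σ N Φ τ χ₂ g Ξ r z := by
  simp only [collisionSum_eq_sum Φ hz]
  rw [← mul_add, ← Finset.sum_add_distrib]
  congr 1
  refine Finset.sum_congr rfl fun s _ => ?_
  rw [← Finset.sum_add_distrib]
  refine Finset.sum_congr rfl fun i _ => ?_
  rw [← Finset.sum_add_distrib]
  refine Finset.sum_congr rfl fun j _ => ?_
  split_ifs
  · ring
  · simp

/-- **Homogeneity in the weight**: `K[(c χ) g Ξ] = c K[χ g Ξ]`. [folklore] -/
theorem collisionSum_const_mul (hz : z ∈ Φ.good) (τ c : ℝ) (χ : ℝ × T3 → ℝ) (g : ℝ → ℝ) (Ξ : V3 × V3 × V3 → ℝ)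
    (r : ℝ) :
    collisionSum σ N Φ τ (fun p => c * χ p) g Ξ r z = c * collisionSum σ N Φ τ χ g Ξ r z := by
  simp only [collisionSum_eq_sum Φ hz]
  rw [mul_left_comm c]
  congr 1
  rw [Finset.mul_sum]
  refine Finset.sum_congr rfl fun s _ => ?_
  rw [Finset.mul_sum]
  refine Finset.sum_congr rfl fun i _ => ?_
  rw [Finset.mul_sum]
  refine Finset.sum_congr rfl fun j _ => ?_
  split_ifs
  · ring
  · simp

/-- **Termwise comparison**: if `|χ₁(s,x) g₁(a) Ξ₁(q) − χ₂(s,x) g₂(a) Ξ₂(q)| ≤ χ₃(s,x) g₃(a) Ξ₃(q)` for all `s ∈ [0, τ]`,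
all `x`, all `a` and all marks `q` with a UNIT normal, then `|K[χ₁ g₁ Ξ₁] − K[χ₂ g₂ Ξ₂]| ≤ K[χ₃ g₃ Ξ₃]` (`0 < σ`).
[folklore] -/
theorem abs_collisionSum_sub_le (hz : z ∈ Φ.good) (hσ : 0 < σ) {τ : ℝ} {χ₁ χ₂ χ₃ : ℝ × T3 → ℝ} {g₁ g₂ g₃ : ℝ → ℝ}
    {Ξ₁ Ξ₂ Ξ₃ : V3 × V3 × V3 → ℝ} (r : ℝ)
    (h : ∀ s ∈ Icc (0 : ℝ) τ, ∀ (x : T3) (a : ℝ) (q : V3 × V3 × V3), ‖q.1‖ = 1 →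
      |χ₁ (s, x) * g₁ a * Ξ₁ q - χ₂ (s, x) * g₂ a * Ξ₂ q| ≤ χ₃ (s, x) * g₃ a * Ξ₃ q) :
    |collisionSum σ N Φ τ χ₁ g₁ Ξ₁ r z - collisionSum σ N Φ τ χ₂ g₂ Ξ₂ r z| ≤ collisionSum σ N Φ τ χ₃ g₃ Ξ₃ r z := by
  have hε := hsDiameter_pos hσ N
  have hc0 : 0 ≤ hsDiameter σ N / (N + 1 : ℝ) := div_nonneg hε.le (by positivity)
  simp only [collisionSum_eq_sum Φ hz]
  rw [← mul_sub, abs_mul, abs_of_nonneg hc0, ← Finset.sum_sub_distrib]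
  refine mul_le_mul_of_nonneg_left ((Finset.abs_sum_le_sum_abs _ _).trans (Finset.sum_le_sum fun s hs => ?_)) hc0
  have hsI : s ∈ Icc (0 : ℝ) τ := ((Set.Finite.mem_toFinset _).1 hs).2
  rw [← Finset.sum_sub_distrib]
  refine (Finset.abs_sum_le_sum_abs _ _).trans (Finset.sum_le_sum fun i _ => ?_)
  rw [← Finset.sum_sub_distrib]
  refine (Finset.abs_sum_le_sum_abs _ _).trans (Finset.sum_le_sum fun j _ => ?_)
  split_ifs with hcond
  · exact h s hsI _ _ _ (norm_inv_smul_of_norm_eq hε hcond.2)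
  · simp

/-- **Monotonicity in the weight** for nonnegative `g`, `Ξ`: `χ₁ ≤ χ₂` on `[0, τ] × 𝕋³` gives `K[χ₁ g Ξ] ≤ K[χ₂ g Ξ]`
(`0 < σ`). [folklore] -/
theorem collisionSum_mono (hz : z ∈ Φ.good) (hσ : 0 < σ) {τ : ℝ} {χ₁ χ₂ : ℝ × T3 → ℝ} {g : ℝ → ℝ}
    {Ξ : V3 × V3 × V3 → ℝ} (r : ℝ) (hχ : ∀ s ∈ Icc (0 : ℝ) τ, ∀ x, χ₁ (s, x) ≤ χ₂ (s, x)) (hg : ∀ a, 0 ≤ g a)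
    (hΞ : ∀ q, 0 ≤ Ξ q) :
    collisionSum σ N Φ τ χ₁ g Ξ r z ≤ collisionSum σ N Φ τ χ₂ g Ξ r z := by
  have h := abs_collisionSum_sub_le Φ hz hσ r (χ₁ := χ₂) (χ₂ := χ₁) (χ₃ := fun p => χ₂ p - χ₁ p)
    (g₁ := g) (g₂ := g) (g₃ := g) (Ξ₁ := Ξ) (Ξ₂ := Ξ) (Ξ₃ := Ξ) (τ := τ) (fun s hs x a q _ => by
      rw [← sub_mul, ← sub_mul, abs_mul, abs_mul, abs_of_nonneg (hg a), abs_of_nonneg (hΞ q),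
        abs_of_nonneg (sub_nonneg.2 (hχ s hs x))])
  have hlin : collisionSum σ N Φ τ (fun p => χ₂ p - χ₁ p) g Ξ r z =
      collisionSum σ N Φ τ χ₂ g Ξ r z - collisionSum σ N Φ τ χ₁ g Ξ r z := by
    have h1 := collisionSum_add Φ hz τ (fun p => χ₂ p - χ₁ p) χ₁ g Ξ r
    simp only [sub_add_cancel] at h1
    linarith
  rw [hlin] at h
  linarith [abs_nonneg (collisionSum σ N Φ τ χ₂ g Ξ r z - collisionSum σ N Φ τ χ₁ g Ξ r z)]

/-- The collision sum of nonnegative weights and marks is nonnegative (`0 < σ`). [folklore] -/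
theorem collisionSum_nonneg (hz : z ∈ Φ.good) (hσ : 0 < σ) {τ : ℝ} {χ : ℝ × T3 → ℝ} {g : ℝ → ℝ}
    {Ξ : V3 × V3 × V3 → ℝ} (r : ℝ) (hχ : ∀ s ∈ Icc (0 : ℝ) τ, ∀ x, 0 ≤ χ (s, x)) (hg : ∀ a, 0 ≤ g a)
    (hΞ : ∀ q, 0 ≤ Ξ q) : 0 ≤ collisionSum σ N Φ τ χ g Ξ r z := by
  have h := collisionSum_mono Φ hz hσ r (χ₁ := fun _ => 0) (χ₂ := χ) (g := g) (Ξ := Ξ) (τ := τ) hχ hg hΞ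
  have h0 : collisionSum σ N Φ τ (fun _ => (0 : ℝ)) g Ξ r z = 0 := by
    have := collisionSum_const_mul Φ hz τ 0 (fun _ => (1 : ℝ)) g Ξ r
    simp only [zero_mul] at this
    exact this
  linarith

/-- **Restriction of the time window by an indicator weight**: for `t ≤ τ`,
`K_τ[(1{s ≤ t} χ) g Ξ] = K_t[χ g Ξ]`. [folklore] -/
theorem collisionSum_indicator (hz : z ∈ Φ.good) {t τ : ℝ} (ht : t ≤ τ) (χ : ℝ × T3 → ℝ) (g : ℝ → ℝ)
    (Ξ : V3 × V3 × V3 → ℝ) (r : ℝ) :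
    collisionSum σ N Φ τ (fun p => if p.1 ≤ t then χ p else 0) g Ξ r z = collisionSum σ N Φ t χ g Ξ r z := by
  simp only [collisionSum_eq_sum Φ hz]
  congr 1
  have hsub : (finite_collisionTimes_Icc Φ hz t).toFinset ⊆ (finite_collisionTimes_Icc Φ hz τ).toFinset := by
    intro s hs
    have h := (Set.Finite.mem_toFinset _).1 hs
    exact (Set.Finite.mem_toFinset _).2 ⟨h.1, h.2.1, h.2.2.trans ht⟩
  rw [← Finset.sum_subset hsub ?_]
  · refine Finset.sum_congr rfl fun s hs => ?_
    have hle : s ≤ t := ((Set.Finite.mem_toFinset _).1 hs).2.2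
    simp only [if_pos hle]
  · intro s hs hs'
    have h := (Set.Finite.mem_toFinset _).1 hs
    have hgt : ¬ s ≤ t := fun hle => hs' ((Set.Finite.mem_toFinset _).2 ⟨h.1, h.2.1, hle⟩)
    simp only [if_neg hgt, zero_mul, ite_self, Finset.sum_const_zero]

end CollisionSum

/-! ## §2 Exchange of the window integral with the collision sum -/

section Exchange

variable {N : ℕ}

/-- **Abstract exchange lemma**: a `(t₀, x₀)`-integral of `a(t₀, x₀)` times a finite sum of tent × cone windowed
terms is the finite sum with the smoothed coefficients (every term is continuous, the sums are finite). [folklore] -/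
theorem integral_integral_mul_sum_window (F : Finset ℝ) (P : ℝ → Fin (N + 1) → Fin (N + 1) → Prop)
    [∀ s i j, Decidable (P s i j)] (y : ℝ → Fin (N + 1) → T3) (G : ℝ → Fin (N + 1) → ℝ)
    (X : ℝ → Fin (N + 1) → Fin (N + 1) → ℝ) (K : ℝ) {a : ℝ × T3 → ℝ} (ha : Continuous a) (lo hi r : ℝ) :
    ∫ t₀ in Icc lo hi, ∫ x₀, a (t₀, x₀) * (K * ∑ s ∈ F, ∑ i, ∑ j,
        (if P s i j then r⁻¹ * max (1 - |s - t₀| / r) 0 * cone r (y s i) x₀ * G s i * X s i j else 0)) =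
      K * ∑ s ∈ F, ∑ i, ∑ j, (if P s i j then
        (∫ t₀ in Icc lo hi, ∫ x₀, a (t₀, x₀) * (r⁻¹ * max (1 - |s - t₀| / r) 0 * cone r (y s i) x₀)) *
          G s i * X s i j else 0) := by
  -- the inner `x₀`-integral, at a fixed `t₀`
  have hac : ∀ (t₀ : ℝ) (y' : T3), Continuous fun x₀ : T3 => a (t₀, x₀) * cone r y' x₀ := fun t₀ y' =>
    (ha.comp (continuous_const.prodMk continuous_id)).mul (continuous_cone r y')
  have hinner : ∀ t₀, ∫ x₀, a (t₀, x₀) * (K * ∑ s ∈ F, ∑ i, ∑ j,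
      (if P s i j then r⁻¹ * max (1 - |s - t₀| / r) 0 * cone r (y s i) x₀ * G s i * X s i j else 0)) =
      K * ∑ s ∈ F, ∑ i, ∑ j, (if P s i j then
        r⁻¹ * max (1 - |s - t₀| / r) 0 * (∫ x₀, a (t₀, x₀) * cone r (y s i) x₀) * G s i * X s i j else 0) := by
    intro t₀
    have hterm : ∀ s i j, Integrable (fun x₀ : T3 => if P s i j then
        a (t₀, x₀) * (r⁻¹ * max (1 - |s - t₀| / r) 0 * cone r (y s i) x₀ * G s i * X s i j) else 0) volume := by
      intro s i j
      split_ifs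
      · exact integrable_of_continuous_T3 ((ha.comp (continuous_const.prodMk continuous_id)).mul
          (((continuous_const.mul (continuous_cone r _)).mul continuous_const).mul continuous_const))
      · exact integrable_const 0
    have hrw : ∀ x₀, a (t₀, x₀) * (K * ∑ s ∈ F, ∑ i, ∑ j,
        (if P s i j then r⁻¹ * max (1 - |s - t₀| / r) 0 * cone r (y s i) x₀ * G s i * X s i j else 0)) =
        K * ∑ s ∈ F, ∑ i, ∑ j, (if P s i j then
          a (t₀, x₀) * (r⁻¹ * max (1 - |s - t₀| / r) 0 * cone r (y s i) x₀ * G s i * X s i j) else 0) := by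
      intro x₀
      rw [mul_left_comm, Finset.mul_sum]
      congr 1
      refine Finset.sum_congr rfl fun s _ => ?_
      rw [Finset.mul_sum]
      refine Finset.sum_congr rfl fun i _ => ?_
      rw [Finset.mul_sum]
      refine Finset.sum_congr rfl fun j _ => ?_
      split_ifs <;> simp
    simp_rw [hrw]
    rw [integral_const_mul, integral_finsetSum _ fun s _ =>
      integrable_finsetSum _ fun i _ => integrable_finsetSum _ fun j _ => hterm s i j]
    congr 1
    refine Finset.sum_congr rfl fun s _ => ?_
    rw [integral_finsetSum _ fun i _ => integrable_finsetSum _ fun j _ => hterm s i j]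
    refine Finset.sum_congr rfl fun i _ => ?_
    rw [integral_finsetSum _ fun j _ => hterm s i j]
    refine Finset.sum_congr rfl fun j _ => ?_
    split_ifs
    · rw [← integral_const_mul, ← integral_mul_const, ← integral_mul_const]
      exact integral_congr_ae (ae_of_all _ fun x₀ => by ring)
    · exact integral_zero _ _
  simp_rw [hinner]
  -- the outer `t₀`-integral
  have hcont : ∀ s i, Continuous fun t₀ : ℝ => r⁻¹ * max (1 - |s - t₀| / r) 0 * ∫ x₀, a (t₀, x₀) * cone r (y s i) x₀ :=
    fun s i => (continuous_tent_sub r s).mul (continuous_integral_mul_cone ha r (y s i))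
  have hterm : ∀ s i j, IntegrableOn (fun t₀ : ℝ => if P s i j then
      r⁻¹ * max (1 - |s - t₀| / r) 0 * (∫ x₀, a (t₀, x₀) * cone r (y s i) x₀) * G s i * X s i j else 0)
      (Icc lo hi) volume := by
    intro s i j
    split_ifs
    · exact (((hcont s i).mul continuous_const).mul continuous_const).continuousOn.integrableOn_compact isCompact_Icc
    · exact integrableOn_const (by rw [Real.volume_Icc]; exact ENNReal.ofReal_ne_top)
  rw [integral_const_mul, integral_finsetSum _ fun s _ =>
    integrable_finsetSum _ fun i _ => integrable_finsetSum _ fun j _ => hterm s i j]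
  congr 1
  refine Finset.sum_congr rfl fun s _ => ?_
  rw [integral_finsetSum _ fun i _ => integrable_finsetSum _ fun j _ => hterm s i j]
  refine Finset.sum_congr rfl fun i _ => ?_
  rw [integral_finsetSum _ fun j _ => hterm s i j]
  refine Finset.sum_congr rfl fun j _ => ?_
  split_ifs
  · rw [← integral_mul_const, ← integral_mul_const]
    refine integral_congr_ae (ae_of_all _ fun t₀ => ?_)
    dsimp only
    rw [integral_mul_tent_mul_cone]
  · exact integral_zero _ _

variable {σ : ℝ} (Φ : HardSphereFlow (Torus.geometry (Fin 3)) (hsDiameter σ N) (N + 1))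
  {z : Config (N + 1) (Fin 3) T3}

/-- **Testing the windowed collision statistic against `a(t₀, x₀)` yields the collision sum with the smoothed
coefficient** `ã(s, x) = ∫_{t₀} ∫_{x₀} a(t₀, x₀) bt(s − t₀) b_r(x, x₀)` (good orbit, continuous `a`). [folklore] -/
theorem integral_integral_mul_collisionSum_window (hz : z ∈ Φ.good) {a : ℝ × T3 → ℝ} (ha : Continuous a)
    (τ lo hi r : ℝ) (g : ℝ → ℝ) (Ξ : V3 × V3 × V3 → ℝ) :
    ∫ t₀ in Icc lo hi, ∫ x₀, a (t₀, x₀) *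
        collisionSum σ N Φ τ (fun p => r⁻¹ * max (1 - |p.1 - t₀| / r) 0 * cone r p.2 x₀) g Ξ r z =
      collisionSum σ N Φ τ (fun p => ∫ t₀ in Icc lo hi, ∫ x₀,
        a (t₀, x₀) * (r⁻¹ * max (1 - |p.1 - t₀| / r) 0 * cone r p.2 x₀)) g Ξ r z := by
  simp only [collisionSum_eq_sum Φ hz]
  exact integral_integral_mul_sum_window _ _ (fun s i => (Φ.flow s z i).1) _ _ _ ha lo hi r

/-- **The boundary-layer inequality.** For nonnegative `g`, `Ξ` and `0 < r < 1/2`, the collisions `s ≤ τ` with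
`[s, s + r] ⊆ [lo, hi]` are counted at most twice by the window integral over `[lo, hi]` of the windowed statistic:
`K_τ[1{lo ≤ s, s + r ≤ hi} g Ξ] ≤ 2 ∫_{t₀ ∈ [lo,hi]} ∫_{x₀} K_τ[bt(· − t₀) b_r(·, x₀) g Ξ]`. [folklore] -/
theorem collisionSum_layer_le (hz : z ∈ Φ.good) (hσ : 0 < σ) {r : ℝ} (hr : 0 < r) (hr2 : r < 1 / 2) (τ lo hi : ℝ)
    {g : ℝ → ℝ} {Ξ : V3 × V3 × V3 → ℝ} (hg : ∀ a, 0 ≤ g a) (hΞ : ∀ q, 0 ≤ Ξ q) :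
    collisionSum σ N Φ τ (fun p => if lo ≤ p.1 ∧ p.1 + r ≤ hi then 1 else 0) g Ξ r z ≤
      2 * ∫ t₀ in Icc lo hi, ∫ x₀,
        collisionSum σ N Φ τ (fun p => r⁻¹ * max (1 - |p.1 - t₀| / r) 0 * cone r p.2 x₀) g Ξ r z := by
  have hex := integral_integral_mul_collisionSum_window Φ hz (a := fun _ => (1 : ℝ)) continuous_const τ lo hi r g Ξ
  simp only [one_mul] at hex
  rw [hex, ← collisionSum_const_mul Φ hz]
  refine collisionSum_mono Φ hz hσ r (fun s _ x => ?_) hg hΞ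
  dsimp only
  have hx : ∀ t₀, ∫ x₀, r⁻¹ * max (1 - |s - t₀| / r) 0 * cone r x x₀ = r⁻¹ * max (1 - |s - t₀| / r) 0 := by
    intro t₀
    have h1 : ∫ x₀, cone r x x₀ = 1 := integral_cone_eq_one hr hr2 x
    rw [integral_const_mul, h1, mul_one]
  simp_rw [hx]
  split_ifs with hmem
  · have h := half_le_setIntegral_tent hr hmem.1 hmem.2
    linarith
  · exact mul_nonneg zero_le_two (setIntegral_tent_nonneg hr s _)

end Exchange

/-! ## §3 Registered sub-goal -/

/-- **Registered sub-goal `stub_pressureValueD` (helper D of `stub_pressureValueOfEnskog`): homogeneity of the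
normalised collision sum in its space–time weight along a good orbit.** [folklore] -/
theorem stub_pressureValueD : ∀ {σ : ℝ} {N : ℕ} (Φ : HardSphereFlow (Torus.geometry (Fin 3)) (hsDiameter σ N) (N + 1)) {z : Config (N + 1) (Fin 3) T3}, z ∈ Φ.good → ∀ (τ c : ℝ) (χ : ℝ × T3 → ℝ) (g : ℝ → ℝ) (Ξ : V3 × V3 × V3 → ℝ) (r : ℝ), collisionSum σ N Φ τ (fun p => c * χ p) g Ξ r z = c * collisionSum σ N Φ τ χ g Ξ r z :=
  fun Φ _ hz τ c χ g Ξ r => collisionSum_const_mul Φ hz τ c χ g Ξ r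

end Summit.AtomisticToContinuum.HydrodynamicLimit.Theorems.ChaosClosesEulerPressureValue

end
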